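import Mathlib
import Summits.ResolutionOfSingularities.ResolutionOfSingularities.Theorems.WeightedInvariantIota3FlagRatioTwoBound
import Summits.ResolutionOfSingularities.ResolutionOfSingularities.Theorems.WeightedInvariantK1OrbitGenericNoSquareFlag
import HarnessLib

/-!
# K1 certificate, piece (C3): in `K⟦T, X, Z⟧` (char 2, `Z⁴`-coefficient a non-square) NO TWO-FLAG REACHES A RATIO `> 2` — assembly of (C1) + (C2)

Route `ResolutionOfSingularities/WeightedInvariant`, door crux `HypersurfaceCentreConstruction` (stmt-ResolutionOfSingularities-19897), P3 rung;
ORDER (o50) (K-wild-hom) of res-L1-w43-plan-1, kernel item «K1 certificate» (memo `plan/tools/res-type-060/o50/K-WILD-HOM.md` §4); res-type-060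
(gen 10).  (C1) = `Iota3.exists_eq_of_mem_flagContactFiltration_two` (`…Iota3FlagRatioTwoBound`), (C2) = `KWildHom.not_eq_sq_flag_form`
(`…K1OrbitGenericNoSquareFlag`).  [OURS · L1 W4.3 · helper, counted 0]; nothing here is a statement of the manuscript under review.  AI proof,
weaker than expert review.

* `KWildHom.le_order_of_mem_maximalIdeal_pow` — the bridge `𝔪ⁿ ⊆ {ord ≥ n}` in a power-series ring over a field;
* **`KWildHom.k1_not_mem_flagContactFiltration_of_two_mul_lt`** — for every two-flag `(g₁, g₂)` of `K⟦T,X,Z⟧` and every triple with `0 < q ≤ r₂`,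
  `2·r₂ < r₁`: `X² + y·Z⁴ + y'·T⁴ + P ∉ flagContactFiltration g₁ g₂ q r₁ r₂ (r₁·2)` — no flag reaches a ratio `> 2` for the completed
  orbit-generic successor of K1; with the homogeneous flag `(X, Z; 1, 2, 1)` reaching ratio `2` this is `σ₁ = 2!·2 = 4 < 5 = σ₁(S, f)`, the (K)
  drop at K1 (memo §4; the descent completion → `B′_η` is by faithful flatness of completion on ideal membership, not typed here).
-/

set_option linter.dupNamespace false -- mandated namespace of this single-conjunct summit

namespace Summit.ResolutionOfSingularities.ResolutionOfSingularities.Theorems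

namespace KWildHom

open MvPowerSeries IsLocalRing
open Summit.ResolutionOfSingularities.ResolutionOfSingularities.Cruxes.HypersurfaceCentreConstruction.LocalEngine

variable {K : Type} [Field K]

/-- **`𝔪ⁿ ⊆ {ord ≥ n}`** in a power-series ring over a field. [folklore] -/
theorem le_order_of_mem_maximalIdeal_pow {σ : Type} (n : ℕ) {F : MvPowerSeries σ K}
    (hF : F ∈ maximalIdeal (MvPowerSeries σ K) ^ n) : (n : ℕ∞) ≤ F.order := by
  induction n generalizing F with
  | zero => simp
  | succ n ih =>
    rw [pow_succ] at hF
    refine Submodule.mul_induction_on hF (fun a ha b hb => ?_) (fun x y hx hy => ?_)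
    · have hb1 : (1 : ℕ∞) ≤ b.order := by
        rw [one_le_order_iff_constCoeff_eq_zero]
        by_contra hne
        exact (IsLocalRing.mem_maximalIdeal _).mp hb (isUnit_iff_constantCoeff.mpr (isUnit_iff_ne_zero.mpr hne))
      calc ((n + 1 : ℕ) : ℕ∞) = (n : ℕ∞) + 1 := by push_cast; rfl
        _ ≤ a.order + b.order := add_le_add (ih ha) hb1
        _ ≤ (a * b).order := le_order_mul
    · exact (le_min hx hy).trans min_order_le_add

/-- **K1 CERTIFICATE**: in `K⟦T,X,Z⟧`, `char K = 2`, `y` NOT a square: for every two-flag `(g₁, g₂)` and every triple with `0 < q ≤ r₂`, `2r₂ < r₁`,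
the germ `X² + y·Z⁴ + y'·T⁴ + P` (`ord P ≥ 5`) does NOT lie in the level-`2r₁` piece of the `(q; r₁, r₂)`-filtration — no two-flag reaches a ratio
`> 2`. [OURS · L1 W4.3] -/
theorem k1_not_mem_flagContactFiltration_of_two_mul_lt [CharP K 2] (y y' : K) (hy : ¬ IsSquare y) (P : MvPowerSeries (Fin 3) K)
    (hP : (5 : ℕ∞) ≤ P.order) (g₁ g₂ : MvPowerSeries (Fin 3) K) (hflag : Iota3.IsTwoFlag g₁ g₂) {q r₁ r₂ : ℕ}
    (hq : 0 < q) (hqr : q ≤ r₂) (hr : 2 * r₂ < r₁) :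
    (X 1 ^ 2 + C y * X 2 ^ 4 + C y' * X 0 ^ 4 + P : MvPowerSeries (Fin 3) K) ∉ Iota3.flagContactFiltration g₁ g₂ q r₁ r₂ (r₁ * 2) := by
  intro hf
  obtain ⟨a, b, c, hb, hc, heq⟩ := Iota3.exists_eq_of_mem_flagContactFiltration_two hflag.2.1 hq hqr hr hf
  have hg₁ : constantCoeff g₁ = 0 := by
    by_contra hne
    exact (IsLocalRing.mem_maximalIdeal _).mp hflag.1 (isUnit_iff_constantCoeff.mpr (isUnit_iff_ne_zero.mpr hne))
  exact not_eq_sq_flag_form y y' hy P a b c g₁ hP (le_order_of_mem_maximalIdeal_pow 3 hb) (le_order_of_mem_maximalIdeal_pow 5 hc) hg₁ heq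

end KWildHom

end Summit.ResolutionOfSingularities.ResolutionOfSingularities.Theorems
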